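import Mathlib
import HarnessLib
import HarnessLib.Audit
import Summits.AtomisticToContinuum.Statement
import Literature.MathematicalPhysics.StatisticalMechanics.LennardJonesClusters
import Literature.MathematicalPhysics.StatisticalMechanics.RootEnergy
import Literature.Probability.Process.PointStationaryLaw
import Summits.AtomisticToContinuum.Crystallization.Theorems.ExcessDecayLiouvilleCrysEnergyLimit
import Summits.AtomisticToContinuum.Crystallization.Theorems.PalmUnimodularRigidityChargedPatternCrystallizes
import Summits.AtomisticToContinuum.Crystallization.Theorems.PricedLinkCensusChargedPeriodicIsOptimal
import HarnessLib.Audit.Status.Attr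

/-!
Route: BenjaminiSchrammPeriodicSupport

# Route BenjaminiSchrammPeriodicSupport — Benjamini–Schramm limits of LJ ground states — minimising
Palm laws charge ONE periodic pattern; attainment by surgery

It suffices to show X = PeriodicSupport (card benjamini-schramm-ground-states, item (iii), on the
Palm side): for every hard core
δ > 0, every probability law P on rooted δ-hard-core configurations of ℝ³ (`IsRootedHardCore`, a.s.)
that is POINT-STATIONARY
(`IsPointStationaryLaw`: the Mecke / mass-transport identity) and MINIMISING (E_P[rootEnergy V_LJ] ≤
e* := ⨅ over periodic Q of e(Q))
charges ONE periodic configuration Q at every scale: for all R, ε > 0, with positive P-probability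
the configuration is two-way
ε-matched on the ball B(0,R) with a rotated copy A(Q.points − q), q ∈ Q.points. This is Radin's
"crystal problem = periodic SUPPORT of
the zero-temperature ground-state measures", asked of the weakest object that still decides the
conjunct: no classification of the
minimisers (hcp vs fcc vs polytype is NOT decided), no intensity / NoFoam hypothesis, no finite-N
surface bookkeeping. Given X, the
exact Benjamini–Schramm construction (shared support BenjaminiSchrammLimit, 9230) and the energy
limit (shared 0626) give the finite-N
hinge GroundStatesChargePeriodic (shared 2911) by the glue SupportToHinge; the hinge decides
`Crystallization` through the shared back
end: surgery-attainment ChargedPeriodicIsOptimal (2913) for conjunct (i) and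
ChargedPatternCrystallizes (2916) for conjunct (ii).
This is the conforming (D-0027 §2.1) re-filing of retired route BenjaminiSchrammGroundStates from
the same card, moved to the Palm side.
Lean: `∀ δ : ℝ, 0 < δ → ∀ P : MeasureTheory.Measure (MeasureTheory.Measure (EuclideanSpace ℝ (Fin
3))), MeasureTheory.IsProbabilityMeasure P → (∀ᵐ μ ∂P,
Literature.Probability.Process.IsRootedHardCore δ μ) →
Literature.Probability.Process.IsPointStationaryLaw P → (∫ μ,
Literature.MathematicalPhysics.StatisticalMechanics.rootEnergy
Literature.MathematicalPhysics.StatisticalMechanics.lennardJones μ ∂P) ≤ (⨅ Q :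
Literature.MathematicalPhysics.StatisticalMechanics.PeriodicConfiguration 3, Q.energyPerParticle
Literature.MathematicalPhysics.StatisticalMechanics.lennardJones) → ∃ Q :
Literature.MathematicalPhysics.StatisticalMechanics.PeriodicConfiguration 3, ∀ R ε : ℝ, 0 < R → 0 <
ε → 0 < P {μ | ∃ A : EuclideanSpace ℝ (Fin 3) →ₗᵢ[ℝ] EuclideanSpace ℝ (Fin 3), ∃ q ∈ Q.points, (∀ s
∈ Q.points, dist s q ≤ R → ∃ y : EuclideanSpace ℝ (Fin 3), μ {y} ≠ 0 ∧ dist y (A (s - q)) ≤ ε) ∧ (∀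
y : EuclideanSpace ℝ (Fin 3), μ {y} ≠ 0 → ‖y‖ ≤ R → ∃ s ∈ Q.points, dist y (A (s - q)) ≤ ε)}`

## Assembly
DECIDING THEOREM (glue.lean, sorry-free against the rendered sketch; axioms propext,
Classical.choice, Quot.sound; 20 lines):
`theorem closes : GroundStatesChargePeriodic → CrysEnergyLimit → ChargedPeriodicIsOptimal →
ChargedPatternCrystallizes → _root_.Crystallization`.
Its hypotheses are the hinge and the three back-end items — the MINIMAL deciding set — so it fires
on any proof of 2911; the thesis
crux reaches the hinge by the item SupportToHinge (X → 9230 → 0626 → 2911, `hinge_of_layer2` in the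
Sketch is modus ponens). Content:
conjunct (ii) is ChargedPatternCrystallizes applied to the hinge and the PROVED fact
LennardJonesMinimalDistance_holds; for conjunct
(i), LennardJonesGroundStatesExist_holds (proved) supplies a ground-state sequence, the hinge ONE
charged periodic Q,
ChargedPeriodicIsOptimal gives `IsLeast (range e) (e Q)`, and `IsLeast.csInf_eq` rewrites
CrysEnergyLimit into
`Tendsto (E(N)/N) (𝓝 (e Q))` — together `HasPeriodicGroundStateEnergy lennardJones 3`.
`_root_.Crystallization` is the `abbrev` of
the Literature conjunction, closed by `show`.

Rationale: WHY THIS LINE. Root each finite ground state at a uniformly random particle: the rooted empirical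
law P_N satisfies the mass-transport principle as a
finite double count and E(N)/N = E_(P_N)[rootEnergy] EXACTLY (AldousSteele2004 objective method,
AldousLyons2007; proved in tree as
`interactionEnergy_div_eq_avg_rootEnergy_lennardJones`, RootEnergy.lean), so every subsequential
local limit is a point-stationary
(= Palm: HevelingLast2005, LastThorisson2009, LastPenrose2017 ch. 9) hard-core law with E_P[h] = lim
E(N)/N = e*, and crystallization
becomes a SUPPORT statement about zero-temperature ground-state measures (RadinSchulman1983,
Radin1987, Radin1991; Bowen–Radin
doi:10.1007/s00454-002-2791-7 for the packing analogue; Lewin2022 Def. 11 / Leble2016 for Riesz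
gases). Imported areas: unimodular
random networks / Palm calculus (probability) and ergodic ground-state theory (aperiodic order); the
finite-N content is isolated in
ONE exact limit (9230) and ONE elementary R³-versus-R² surgery (2913) that turns "a periodic pattern
is charged with positive density"
into "the periodic infimum is attained THERE", so conjunct (i) needs no identification of the
minimiser. What it does that the open
routes do not: PalmUnimodularRigidity (sibling card) bets on CLASSIFYING the minimisers as relaxed
hcp (MinimiserShells +
ShellsToBarlowChart + LayeredLawsSelectHcp; refuted-misstated if fcc or a polytype wins at the 1e-4
level); X here only asks that SOME
periodic pattern be charged — it survives an fcc/hcp reversal and any periodic winner, and dies only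
if LJ minimisers are amorphous or
aperiodically stacked; HolmgrenBoyleLind reaches the same hinge through FLC + unique continuation,
SurfaceTensionFirst / GscLoopSurgery
(retired) through finite-N cohesion; the retired gen-1 filing of this card worked on the STATIONARY
side and needed the finite-N cohesion
crux NoFoam plus Palm inversion — on the Palm side neither is needed (the limit is used as it
comes), and the deciding theorem `closes`
is stated over the hinge and the back end only, so that ANY proof of 2911 (this route's layer 2, the
Palm classification, or a direct
finite-N argument) fires it. Negatives index (6 entries, 2 on this sub-problem: 4146 local 1%-shell
lemma, 3506 multiplicity-blind
window gluing for NON-injective configurations) is steered around: every configuration here is a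
ground state (injective, uniformly
separated by LennardJonesMinimalDistance_holds) or an a.s. hard-core law.

RANKED CRUXES. #2 PeriodicSupport (crux) — (card item (iii), Palm side; the thesis X) for every δ >
0 and every probability law P on `Measure (EuclideanSpace ℝ (Fin 3))` with P-a.s. `IsRootedHardCore
δ μ` (μ = count|S, 0 ∈ S, S δ-separated), `IsPointStationaryLaw P` (Mecke identity for all jointly
measurable g ≥ 0) and ∫ rootEnergy V_LJ dP ≤ ⨅_Q e(Q), there is ONE periodic configuration Q such
that for all R, ε > 0 the event "∃ linear isometry A, ∃ q ∈ Q.points: every s ∈ Q.points with dist s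
q ≤ R has a point y of μ with dist y (A(s − q)) ≤ ε, and every point y of μ with ‖y‖ ≤ R has s ∈
Q.points with dist y (A(s − q)) ≤ ε" has positive (outer) P-measure. Hypothesis block = the frame of
PalmUnimodularRigidity.PalmRigidity folded through the three landed definitions (Iff.rfl), so
PalmRigidity ⇒ PeriodicSupport by support selection; the converse is not claimed. [difficulty:
open-problem] (why it might fail: Generic interactions have weakly-mixing, non-periodic ground-state
measures (van Enter–Miękisz arXiv:2009.02586; Radin's tiles, Sütő): LJ-specific input is essential;
an amorphous/polytetrahedral minimising Palm law, or Sturmian optimal stackings if |J₂|-domination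
(0670) fails, refutes it.) [Radin1991, Radin1987, RadinSchulman1983, arXiv:2009.02586,
doi:10.1007/s00454-002-2791-7, AldousLyons2007, Lewin2022, BlancLewin2015,
stmt-AtomisticToContinuum-0670]
#3 GroundStatesChargePeriodic (crux) — (SHARED item stmt-AtomisticToContinuum-2911, the finite-N
hinge; byte-identical) for every sequence of LJ ground states x^N in ℝ³ there is ONE periodic
configuration Q such that for all R, ε > 0 some ρ > 0 bounds from below, for infinitely many N, the
fraction of particles i whose R-neighbourhood is two-way ε-matched with x_i + A(Q.points − q) for
some linear isometry A and base point q ∈ Q.points. In this route it is the OUTPUT of SupportToHinge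
(layer 2) and the INPUT of the deciding theorem; a direct proof by any other means closes the route
as well. [deps: PeriodicSupport] [difficulty: XL] (why it might fail: Needs ONE Q charged with
density ρ(R,ε) > 0 at every scale for infinitely many N: false if LJ bulk minimisers are
aperiodically stacked (domination fails), form a non-closed degenerate family, or if minimising
limits are amorphous; Blanc–Lewin (ii) could still hold through rare windows.) [BlancLewin2015,
FlatleyTheil2015, Radin1991, AldousSteele2004, stmt-AtomisticToContinuum-2911]
#9 SupportToHinge (support) — (glue of layer 2; kind glue) PeriodicSupport → BenjaminiSchrammLimit →
CrysEnergyLimit → GroundStatesChargePeriodic, with the middle antecedent written out as item 9230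
FOLDED through the three landed definitions (definitionally equal: `hinge_of_layer2` in the Sketch
applies the glue to a proof of the item BenjaminiSchrammLimit by `exact`; the gate renders support
items in id order, so the glue cannot name the later-sorted decl). Proof: given a ground-state
sequence, 9230 gives φ, δ, P (point-stationary, a.s. rooted δ-hard-core, E_P[h] = lim E(φ j)/φ j)
with its density-transfer clause; 0626 and tendsto_nhds_unique give E_P[h] = e* ≤ e*; fold the frame
into IsRootedHardCore / IsPointStationaryLaw / rootEnergy (Iff.rfl, rfl); PeriodicSupport gives Q
with P(T) > 0 for T := the matching event at (R + 1, ε/2); the transfer clause at radius R + 1,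
tolerance ε/2 and ρ := P(T).toReal/2 gives, for all large j, ≥ ρ·φ(j) particles whose recentred
configuration is (ε/2)-matched to some ν ∈ T, hence (triangle inequality, ‖A(s − q)‖ = dist s q)
ε-matched to A(Q.points − q) on B_R — eventually along φ implies frequently in N. Pure bookkeeping
over finite configurations (Set.range (x k − x i), Nat.card monotonicity). [difficulty: M]
[AldousLyons2007, AldousSteele2004, stmt-AtomisticToContinuum-9230, stmt-AtomisticToContinuum-2911]
#9 BenjaminiSchrammLimit (support) — (SHARED item stmt-AtomisticToContinuum-9230 of
PalmUnimodularRigidity, byte-identical; the CONSTRUCTION, existence kept separate from the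
interface) for every sequence of LJ ground states there are a subsequence φ, a hard core δ > 0 and a
probability law P on rooted δ-separated configurations which is point-stationary, has E_P[h] = lim_j
E(φ j)/φ j, and is a local limit in density-transfer (portmanteau) form: for every set T of
configurations, R, ε > 0 and ρ < P(T), for all large j at least ρ·φ(j) particles have their
recentred configuration (R, ε)-matched to some ν ∈ T. Exact mass transport at finite N, compactness
of rooted hard-core configurations (LennardJonesMinimalDistance_holds), continuity of h (r⁻³ tail),
Skorokhod/portmanteau; refuters ask provers to expect measurable/open T first (outer measure as
typed). [difficulty: XL] [AldousLyons2007, AldousSteele2004, LastPenrose2017, HevelingLast2005,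
BlancLewin2015, stmt-AtomisticToContinuum-9230]
#9 ChargedPeriodicIsOptimal (support) — (SHARED item stmt-AtomisticToContinuum-2913, byte-identical;
card item A3, SURGERY-ATTAINMENT — conjunct (i) from a support statement) if a periodic Q is charged
by some LJ ground-state sequence with positive density at every scale (the conclusion of the hinge
for this Q) then e(Q) is the LEAST periodic energy per particle. Sketch (grounded g13-40,
refuter-rederived fa0ad0ee): if e(Q′) < e(Q) − η, take R large, ε small, a frequent N with ≥ ρN good
particles, ≥ ρN/(C R³) disjoint good R-balls (hard-core packing); excise each patch (n ≈ |Q ∩ B_R|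
particles, self-energy ≥ n e(Q) − Cεn − CR²) and insert a Q′-patch of radius ≤ R − 1 with n′ ≤ n
particles (margin 1 ⇒ new cross terms ≤ 0, lennardJones_nonpos); E(N′) ≤ E(N) + k[n′e(Q′) − n e(Q) +
CR² + Cεn]; with E(M)/M → e_∞ (BlancLewin2015_8_holds, proved) and e_∞ ≤ e(Q′) by trial states: 0 ≤
k[−nη + CR² + Cεn] + o(N), absurd for R large since k n ≥ cρN. [difficulty: M] [BlancLewin2015,
AldousSteele2004, stmt-AtomisticToContinuum-2913]
#9 ChargedPatternCrystallizes (support) — (SHARED soft item stmt-AtomisticToContinuum-2916,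
byte-identical) GroundStatesChargePeriodic → LennardJonesMinimalDistance → IsCrystallizing
lennardJones 3: diagonal choice of scales (k, 1/k), good particles i_k, isometries A_k → A by
compactness of O(3), τ_k := −x_(i_k); PeriodicConfiguration.tendsto_sum_of_eventually_near′
(CrystallizationLocalLimit.lean) gives local convergence to the rotated, re-based periodic
configuration, multiplicity 1. The middle hypothesis is PROVED in tree
(LennardJonesMinimalDistance_holds) and is supplied by `closes`. [difficulty: M] [BlancLewin2015,
stmt-AtomisticToContinuum-2916]
#9 CrysEnergyLimit (support) — (SHARED bookkeeping item stmt-AtomisticToContinuum-0626,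
byte-identical) E(N)/N → ⨅ over periodic configurations of the LJ energy per particle in d = 3
(periodisation of a ground state with margin 1 gives E(N)/N ≥ e*, cross-copy terms being negative;
trial blocks of Q give limsup ≤ e(Q); BlancLewin2015_8_holds gives the limit e_∞). Used twice: to
make the Benjamini–Schramm limit minimising (glue) and, rewritten by IsLeast.csInf_eq, as the
convergence clause of HasPeriodicGroundStateEnergy (closes). [difficulty: M] [BlancLewin2015,
stmt-AtomisticToContinuum-0626]

TWO-LAYER PLAN. Layer 2 is filed at open as ONE glued decomposition of the hinge:
GroundStatesChargePeriodic ⇐ PeriodicSupport → BenjaminiSchrammLimit →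
CrysEnergyLimit → GroundStatesChargePeriodic (glue SupportToHinge). Foreseen, NOT filed:
PeriodicSupport ⇐ LocalOrderAlmostSurely
(minimising point-stationary hard-core laws are a.s. locally close-packed / Barlow-layered — the
measure-level local energy inequality,
sharing territory with PalmUnimodularRigidity.MinimiserShells 9225 and ShellsToBarlowChart 9227,
which may simply be WANTED here) →
LayeredMinimisersChargePeriodicStacking (a minimising law carried by Barlow stackings charges a
PERIODIC stacking: linearity of
E_P[h] in the Hägg-word statistics + |J₂|-domination in density form ⇒ the optimal word has period ≤
2, either sign of J₂) →
PeriodicSupport (k = 2, depth 1). Split only when 9230 or 2913 closes or a prover releases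
PeriodicSupport with a census.

KILL CRITERIA. An explicit minimising point-stationary hard-core law charging no periodic pattern
(amorphous, quasicrystalline, or built on an
aperiodic optimal Hägg word if the certified domination of 0670/3063 FAILS) refutes PeriodicSupport:
close `refuted:PeriodicSupport`
unless the witness is provably not a Benjamini–Schramm limit of ground states, in which case restate
X restricted to such limits (one
`--restate`, the hinge untouched). GroundStatesChargePeriodic refuted (a ground-state sequence
charging no single periodic Q with
positive density) kills this route and every hinge-sharing route (HolmgrenBoyleLind,
PalmUnimodularRigidity's PalmToHinge) — record the
witness; Blanc–Lewin (ii) may survive through rare windows, so the conjunct is not thereby refuted.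
ChargedPeriodicIsOptimal can only be
refuted-misstated (bookkeeping) — repair by restate. Mooted by: PalmRigidity (9224) proved ⇒
PeriodicSupport follows by support
selection and the two routes merge downstream (close the later one `superseded`); Crystallization
proved elsewhere; refutation of
attainment 0627 (aperiodic optimal stacking with unattained infimum) kills conjunct (i) for every
route.

NOT DECOMPOSED YET. The local (vague) topology on rooted hard-core configurations, weak closure of
point-stationarity, measurability of h and of matching
events, and the Skorokhod/portmanteau transfer — all inside BenjaminiSchrammLimit (9230, shared; one
definition request below); the
seam constants, disjoint-patch selection and the n′ ≤ n normalisation of the surgery (inside 2913);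
rotation bookkeeping (inside 2916);
e_uni ≥ e* for ALL point-stationary hard-core laws
(PalmUnimodularRigidity.UnimodularEnergyLowerBound 9229 — the θ = 0 case of the
local inequality behind PeriodicSupport; deliberately NOT an item here: refuters rate it
summit-energy-hard and the chain does not use
it); ergodic decomposition (PeriodicSupport is stated for all minimising laws; extreme points
suffice and provers may reduce); the
finite-N cohesion statement NoFoam of the gen-1 filing (2912, closed moot) — unnecessary on the Palm
side, where cohesion is the
density-zero statement "minimisers see no surface" inside PeriodicSupport. No third layer will be
filed; lemmas ride with --supports.

CHEAPEST FALSIFIER. (1) The certified interlayer computation LjRegistryDomination (items 0670 /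
3063, kit minutes uncertified, interval arithmetic for a
certificate): |J₂| > Σ_(k≥3) (k−1)|J_k| on the relaxed (a, h)-box — EITHER sign of J₂ keeps
PeriodicSupport alive (period ≤ 2), failure
of domination opens the Sturmian-stacking counterexample to both cruxes; refuter float sums (g40-56,
lj_stackings.py) give
J₂ ≈ −7.3e−5 and ratio ∈ [287, 587]. (2) Junk audit of PeriodicSupport, done by hand at filing: the
lone-root law δ_(δ₀) is
point-stationary and hard-core but E[h] = 0 > e* (not minimising); uniformly re-rooted finite
clusters have E[h] = E_N(x)/N > e*
strictly; the rooted Bravais lattice law δ_(count|L) is minimising iff e(L) = e*, and then Q := L is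
charged (consistent, and the
reason X survives an fcc win); ⨅ is genuine given CrysPeriodicBddBelow 0714 (true, shared,
provable-now). (3) `lean check` of the
Sketch: closes rc 0, standard axioms (done).

NUMBERS. Tree normalisation V = r⁻¹²/12 − r⁻⁶/6, r₀ = 1, min −1/12, V(0) = 0 (junk-free root term),
V < 0 beyond 2^(−1/6) ≈ 0.891; scale-optimised
lattice sums (refuter g40-56, uncertified): e(fcc) = −0.717515, e(hcp) = −0.717590, e(dhcp) =
−0.717552, e(9R) = −0.717564, a* = 0.9712,
so hcp leads every tested Barlow polytype by ≥ 2.6e−5 and fcc by 7.5e−5 (1.0e−4 relative); J₂ ≈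
−7.3e−5, domination ratio ∈ [287, 587]
(items 0670/3063, uncertified). Hard core of LJ ground states: LennardJonesMinimalDistance_holds
(qualitative ∃ δ). Items at open: 8
(2 cruxes, 5 support of which 4 shared — 2911 is the shared crux, 9230/2913/2916/0626 shared
supports — 1 assembly); `closes` over 4.

DEFINITION REQUESTS. None load-bearing: `Literature.Probability.Process.IsPointStationaryLaw`,
`IsRootedHardCore` (PointStationaryLaw.lean) and
`Literature.MathematicalPhysics.StatisticalMechanics.rootEnergy` (RootEnergy.lean) have LANDED and
are used by PeriodicSupport. To be
filed after open against SupportToHinge (convenience for 9230's provers, suggested by grounder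
g17-5): the LOCAL (vague) TOPOLOGY /
two-way (R, ε)-matching predicate on rooted locally finite configurations of ℝᵈ
(`Literature/Probability/Process`), so that the
transfer clause of 9230 and the matching events of 2911 / PeriodicSupport fold to one notion.

Novelty: Searches (2026-08-15, this seat): `lit search --hybrid "Palm measure point process energy minimizing
periodic support crystallization
Lennard-Jones"` (12 docs, vector leg only: Baake–Grimm 2013, Friedli–Velenik — none on point); `lit
vsearch "support of an
energy-minimizing translation-invariant measure contains a periodic configuration …"` (10 books:
Friedli–Velenik p.358, Baake–Grimm,
Alicandro–Braides–Cicalese 2023 — lattice Gibbs / aperiodic order / discrete Γ-convergence, no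
support-periodicity theorem for LJ);
`lit search --source zbmath "ground state measures"` (20: van Enter–Miękisz 2020 arXiv:2009.02586
generic ground states — cited as the
genericity warning; Caffarelli–de la Llave 2005; rest irrelevant); zbmath "energy minimizing
stationary point process ground state
periodic support" (0), "ergodic optimization periodic minimizing measure lattice gas ground state"
(0); `lit galaxy search "ground state
measures" --star all` (1, irrelevant) and `"zero-temperature limit of Gibbs point process" --star
all` (0); openalex / s2 HTTP 429 all
session; plus the gen-1 searches recorded on the card and two refuter novelty audits (refuter-2,
refuter-14: crossref / zbMATH sweeps,
Bowen–Radin found) and the grounder stamps on 2911/2913/9230 (nothing printed beyond the objective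
method and Radin's programme).
Nearest prior art found: AldousSteele2004 + AldousLyons2007 (doi:10.1214/EJP.v12-463; objective
method: uniform rooting, exact MTP,
lim cost_N/N = E[cost at root]); Radin1991  [refs: 10.1214/EJP.v12-463, 10.1007/s00454-002-2791-7, 2009.02586, 2202.09240, doi:10.1214/EJP.v12-463, doi:10.1007/s00454-002-2791-7, AldousSteele2004, AldousLyons2007, Radin1991, Radin1987, RadinSchulman1983, Lewin2022, Leble2016, Dereudre2019, Georgii1994]

Barriers (technique_class: benjamini-schramm-limit ground-state-measures surgery): - technique_class: benjamini-schramm-limit ground-state-measures surgery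
- Literature.Barriers.AtomisticToContinuum.AperiodicTilingGroundStates: APPLIES to any
potential-generic form of PeriodicSupport (Radin's Wang-tile lattice gas has ground-state measures
with no periodic configuration in their support; NoPeriodicGroundStateConfig); evaded only because X
is stated for the Lennard-Jones pair potential alone and must be proved with LJ-specific input
(hard-core local order + the r⁻⁶ tail selecting a periodic stacking); the framework itself is
barrier-neutral and would correctly return "no periodic Q" for the tile gas — van Enter–Miękisz 2020
(generic interactions: weakly mixing, non-periodic ground states) is the same warning in measure
language.
- Literature.Barriers.AtomisticToContinuum.SutoDegenerateGroundStates: not met — LJ is not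
Fourier-positive / band-limited and X is a zero-pressure (energy per particle) statement; for a Sütő
potential the framework returns a large face of minimisers that still CONTAINS periodic extreme
points, so the surgery-attainment half survives while uniqueness fails — exactly the
potential-specific split; X asks for one charged periodic Q, not uniqueness.
- Literature.Barriers.AtomisticToContinuum.KissingTwelveDegeneracy: APPLIES to the stacking half of
X (every Hägg walk is a 12-kissed packing; AperiodicKissingTwelvePackings); evaded by the r⁻⁶ tail
acting through the interlayer couplings J_k beyond √(8/3)·a — X needs only |J₂|-domination (pe

History (route lifecycle, newest last):
- 2026-08-23T18:48:32Z · DORMANT — reconciler: no traction for 6.2 d (last activity item-proof-filed at 2026-08-17T14:16:43Z); parked, not closed — `ledger route dormant route-AtomisticToContinuu (operator:999:4168042)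
- 2026-08-30T17:51:42Z · REACTIVATED (open) — reconciler: reactivated — activity statement-checked at 2026-08-30T16:52:29Z after parking at 2026-08-23T18:48:32Z (operator:999:1945891)

sub-problem: Crystallization · status: open · opened planner-plancard-AtomisticToContinuum-Crystal-e7276692-g2-0 2026-08-15T18:56:19Z · rev 1 · ledger route-AtomisticToContinuum-BenjaminiSchrammPeriodicSupport
GENERATED by the gate from the ledger (D-0016/17). Provers cite these decls: `theorem foo : Summit.AtomisticToContinuum.Crystallization.Theses.BenjaminiSchrammPeriodicSupport.<Decl> := …` in Summits/AtomisticToContinuum/Crystallization/Theorems/<Name>.lean.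
-/

namespace Summit.AtomisticToContinuum.Crystallization.Theses.BenjaminiSchrammPeriodicSupport

open scoped BigOperators Topology Manifold Classical MeasureTheory ProbabilityTheory Matrix InnerProductSpace ComplexConjugate ContinuousMap
open Filter Set Function TopologicalSpace MeasureTheory

attribute [summit_statement] _root_.Crystallization

/-- item stmt-AtomisticToContinuum-2911 · crux · rank 3 · open · by planner
why it might fail: Needs ONE Q charged with density ρ(R,ε) > 0 at every scale for infinitely many N: false if LJ bulk minimisers are aperiodically stacked (domination fails), form a non-closed degenerate family, or if minimising limits are amorphous; Blanc–Lewin (ii) could still hold through rare windows.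
sources: BlancLewin2015, FlatleyTheil2015, Radin1991, AldousSteele2004, stmt-AtomisticToContinuum-2911
[crux] (finite-N hinge; deterministic shadow of "the Benjamini–Schramm limit of the ground states
charges Q") for every sequence of LJ ground states x^N in ℝ³ there is ONE periodic configuration Q
such that for all R, ε > 0 there is ρ > 0 with, for infinitely many N, at least ρN particles i whose
R-neighbourhood x^N ∩ B_R(x_i) is ε-matched both ways with x_i + A(Q.points − q) for some linear
isometry A and some base point q ∈ Q.points (base point in Q.points, not a fixed origin: no
vertex-transitivity is forced, cf. refuter note on 0751). Weaker than BulkDefectVanish 0751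
(fraction → 1, fixed HCP): positive density, frequently in N, any periodic Q. [deps:
StationaryMinimisersChargePeriodic, NoFoam] [difficulty: XL] -/
@[route_item "route-AtomisticToContinuum-BenjaminiSchrammPeriodicSupport", crux]
def GroundStatesChargePeriodic : Prop :=
  ∀ x : (N : ℕ) → (Fin N → EuclideanSpace ℝ (Fin 3)), (∀ N, Literature.MathematicalPhysics.StatisticalMechanics.IsGroundState Literature.MathematicalPhysics.StatisticalMechanics.lennardJones (x N)) → ∃ Q : Literature.MathematicalPhysics.StatisticalMechanics.PeriodicConfiguration 3, ∀ R ε : ℝ, 0 < R → 0 < ε → ∃ ρ : ℝ, 0 < ρ ∧ ∃ᶠ N : ℕ in Filter.atTop, ρ * (N : ℝ) ≤ (Nat.card {i : Fin N // ∃ A : EuclideanSpace ℝ (Fin 3) →ₗᵢ[ℝ] EuclideanSpace ℝ (Fin 3), ∃ q ∈ Q.points, (∀ s ∈ Q.points, dist s q ≤ R → ∃ j : Fin N, dist (x N j) (x N i + A (s - q)) ≤ ε) ∧ (∀ j : Fin N, dist (x N j) (x N i) ≤ R → ∃ s ∈ Q.points, dist (x N j) (x N i + A (s - q)) ≤ ε)}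 : ℝ)

/-- item stmt-AtomisticToContinuum-12747 · aside · rank 2 · open · by planner
why it might fail: Generic interactions have weakly-mixing, non-periodic ground-state measures (van Enter–Miękisz arXiv:2009.02586; Radin's tiles, Sütő): LJ-specific input is essential; an amorphous/polytetrahedral minimising Palm law, or Sturmian optimal stackings if |J₂|-domination (0670) fails, refutes it.
sources: Radin1991, Radin1987, RadinSchulman1983, arXiv:2009.02586, doi:10.1007/s00454-002-2791-7, AldousLyons2007
[crux] (card item (iii), Palm side; the thesis X) for every δ > 0 and every probability law P on
`Measure (EuclideanSpace ℝ (Fin 3))` with P-a.s. `IsRootedHardCore δ μ` (μ = count|S, 0 ∈ S, S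
δ-separated), `IsPointStationaryLaw P` (Mecke identity for all jointly measurable g ≥ 0) and ∫
rootEnergy V_LJ dP ≤ ⨅_Q e(Q), there is ONE periodic configuration Q such that for all R, ε > 0 the
event "∃ linear isometry A, ∃ q ∈ Q.points: every s ∈ Q.points with dist s q ≤ R has a point y of μ
with dist y (A(s − q)) ≤ ε, and every point y of μ with ‖y‖ ≤ R has s ∈ Q.points with dist y (A(s −
q)) ≤ ε" has positive (outer) P-measure. Hypothesis block = the frame of
PalmUnimodularRigidity.PalmRigidity folded through the three landed definitions (Iff.rfl), so
PalmRigidity ⇒ PeriodicSupport by support selection; the converse is not claimed. [difficulty: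
open-problem] -/
@[route_item "route-AtomisticToContinuum-BenjaminiSchrammPeriodicSupport", crux]
def PeriodicSupport : Prop :=
  ∀ δ : ℝ, 0 < δ → ∀ P : MeasureTheory.Measure (MeasureTheory.Measure (EuclideanSpace ℝ (Fin 3))), MeasureTheory.IsProbabilityMeasure P → (∀ᵐ μ ∂P, Literature.Probability.Process.IsRootedHardCore δ μ) → Literature.Probability.Process.IsPointStationaryLaw P → (∫ μ, Literature.MathematicalPhysics.StatisticalMechanics.rootEnergy Literature.MathematicalPhysics.StatisticalMechanics.lennardJones μ ∂P) ≤ (⨅ Q : Literature.MathematicalPhysics.StatisticalMechanics.PeriodicConfiguration 3, Q.energyPerParticle Literature.MathematicalPhysics.StatisticalMechanics.lennardJones) → ∃ Q : Literature.MathematicalPhysics.StatisticalMechanics.PeriodicConfiguration 3, ∀ R ε : ℝ, 0 < R → 0 < ε → 0 < P {μ | ∃ A : EuclideanSpace ℝ (Fin 3) →ₗᵢ[ℝ] EuclideanSpace ℝ (Fin 3), ∃ q ∈ Q.points, (∀ s ∈ Q.points, dist s q ≤ R → ∃ y : EuclideanSpace ℝ (Fin 3), μ {y} ≠ 0 ∧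 dist y (A (s - q)) ≤ ε) ∧ (∀ y : EuclideanSpace ℝ (Fin 3), μ {y} ≠ 0 → ‖y‖ ≤ R → ∃ s ∈ Q.points, dist y (A (s - q)) ≤ ε)}

/-- item stmt-AtomisticToContinuum-0626 · support · rank 9 · closed · proved by Summit.AtomisticToContinuum.Crystallization.Theorems.crysEnergyLimit_proof @ f456c3bab3f9 (prover) · by planner
sources: BlancLewin2015, stmt-AtomisticToContinuum-0626
Energetic crystallization: E(N)/N converges to the infimum over periodic (multi-lattice)
configurations of the LJ energy per particle in d = 3. Lower bound liminf ≥ ⨅ is the content ((a)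
local optimality + (d) + surface term O(N^{2/3})); upper bound is filed separately. -/
@[route_item "route-AtomisticToContinuum-BenjaminiSchrammPeriodicSupport", crux]
def CrysEnergyLimit : Prop :=
  Filter.Tendsto (fun N : ℕ => Literature.MathematicalPhysics.StatisticalMechanics.groundStateEnergy Literature.MathematicalPhysics.StatisticalMechanics.lennardJones 3 N / N) Filter.atTop (nhds (⨅ Q : Literature.MathematicalPhysics.StatisticalMechanics.PeriodicConfiguration 3, Q.energyPerParticle Literature.MathematicalPhysics.StatisticalMechanics.lennardJones))

/-- `CrysEnergyLimit` holds: proved by `Summit.AtomisticToContinuum.Crystallization.Theorems.crysEnergyLimit_proof` @ f456c3bab3f9. -/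
theorem CrysEnergyLimit_holds : CrysEnergyLimit := _root_.Summit.AtomisticToContinuum.Crystallization.Theorems.crysEnergyLimit_proof

/-- item stmt-AtomisticToContinuum-12748 · support · rank 9 · closed · proved by Summit.AtomisticToContinuum.Crystallization.Theorems.supportToHinge_proof @ 5497e8393cba (prover) · by planner
sources: AldousLyons2007, AldousSteele2004, stmt-AtomisticToContinuum-9230, stmt-AtomisticToContinuum-2911
[support] (glue of layer 2; kind glue) PeriodicSupport → BenjaminiSchrammLimit → CrysEnergyLimit →
GroundStatesChargePeriodic, with the middle antecedent written out as item 9230 FOLDED through the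
three landed definitions (definitionally equal: `hinge_of_layer2` in the Sketch applies the glue to
a proof of the item BenjaminiSchrammLimit by `exact`; the gate renders support items in id order, so
the glue cannot name the later-sorted decl). Proof: given a ground-state sequence, 9230 gives φ, δ,
P (point-stationary, a.s. rooted δ-hard-core, E_P[h] = lim E(φ j)/φ j) with its density-transfer
clause; 0626 and tendsto_nhds_unique give E_P[h] = e* ≤ e*; fold the frame into IsRootedHardCore /
IsPointStationaryLaw / rootEnergy (Iff.rfl, rfl); PeriodicSupport gives Q with P(T) > 0 for T := the
matching event at (R + 1, ε/2); the transfer clause at radius R + 1, tolerance ε/2 and ρ :=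
P(T).toReal/2 gives, for all large j, ≥ ρ·φ(j) particles whose recentred configuration is
(ε/2)-matched to some ν ∈ T, hence (triangle inequality, ‖A(s − q)‖ = dist s q) ε-matched to
A(Q.points − q) on B_R — eventually along φ implies frequently in N. Pure bookkeeping over finite
configurations (Set.range (x k -/
@[route_item "route-AtomisticToContinuum-BenjaminiSchrammPeriodicSupport"]
def SupportToHinge : Prop :=
  PeriodicSupport → (∀ x : (N : ℕ) → (Fin N → EuclideanSpace ℝ (Fin 3)), (∀ N, Literature.MathematicalPhysics.StatisticalMechanics.IsGroundState Literature.MathematicalPhysics.StatisticalMechanics.lennardJones (x N)) → ∃ φ : ℕ → ℕ, StrictMono φ ∧ ∃ δ : ℝ, 0 < δ ∧ ∃ P : MeasureTheory.Measure (MeasureTheory.Measure (EuclideanSpace ℝ (Fin 3))), MeasureTheory.IsProbabilityMeasure P ∧ (∀ᵐ μ ∂P, Literature.Probability.Process.IsRootedHardCore δ μ) ∧ Literature.Probability.Process.IsPointStationaryLaw P ∧ Filter.Tendsto (fun j : ℕ => Literature.MathematicalPhysics.StatisticalMechanics.groundStateEnergy Literature.MathematicalPhysics.StatisticalMechanics.lennardJones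 3 (φ j) / (φ j : ℝ)) Filter.atTop (nhds (∫ μ, Literature.MathematicalPhysics.StatisticalMechanics.rootEnergy Literature.MathematicalPhysics.StatisticalMechanics.lennardJones μ ∂P)) ∧ ∀ T : Set (MeasureTheory.Measure (EuclideanSpace ℝ (Fin 3))), ∀ R ε : ℝ, 0 < ε → ∀ ρ : ℝ, ρ < (P T).toReal → ∀ᶠ j : ℕ in Filter.atTop, ρ * (φ j : ℝ) ≤ (Nat.card {i : Fin (φ j) // ∃ ν ∈ T, ((∀ p : EuclideanSpace ℝ (Fin 3), ν {p} ≠ 0 → ‖p‖ ≤ R → ∃ q ∈ (Set.range (fun k : Fin (φ j) => x (φ j) k - x (φ j) i)), dist q p ≤ ε) ∧ (∀ q ∈ (Set.range (fun k : Fin (φ j) => x (φ j) k - x (φ j) i)), ‖q‖ ≤ R → ∃ p : EuclideanSpace ℝ (Fin 3), ν {p} ≠ 0 ∧ dist q p ≤ ε))} : ℝ)) → CrysEnergyLimit → GroundStatesChargePeriodic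

-- `SupportToHinge` holds: proved by `Summit.AtomisticToContinuum.Crystallization.Theorems.supportToHinge_proof` @ 5497e8393cba (its module imports this route file, so no `_holds` link can be stated here).

/-- item stmt-AtomisticToContinuum-2913 · support · rank 9 · closed · proved by Summit.AtomisticToContinuum.Crystallization.Theorems.chargedPeriodicIsOptimal_proof (prover) · by planner
sources: BlancLewin2015, AldousSteele2004, stmt-AtomisticToContinuum-2913
[support] (card item A3, SURGERY-ATTAINMENT; conjunct (i) from a support statement) if a periodic
configuration Q is charged by some sequence of LJ ground states with positive density at every scale
(the conclusion of GroundStatesChargePeriodic for this Q), then e(Q) is the least value of the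
energy per particle over all periodic configurations. Proof sketch: if e(Q') < e(Q), pick R ≫
1/(e(Q) − e(Q')) and ε small; along the infinitely many N with ≥ ρN good particles select ≥ ρN/(C
R³) disjoint good R-balls (hard-core packing bound, in tree), excise each patch (n ≈ |Q ∩ B_R|
particles, self-energy ≥ n e(Q) − Cεn − CR², cross terms ≥ −CR² by the r⁻⁶ tail and
LennardJonesMinimalDistance) and insert a Q'-patch of radius R − 1 with n' ≤ n particles (margin 1 ⇒
all new cross terms ≤ 0); compare E(N') ≤ E_mod with E(M)/M → e_∞ (BlancLewin2015_8_holds, proved)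
and e_∞ ≤ e(Q') (trial states, 0629): 0 ≤ k[(n' − n)(e(Q') − e_∞) − n(e(Q) − e(Q')) + CR² + Cεn] +
o(N) with k ≥ cρN/R³ is absurd for R large. No Wulff shapes, no rates. [difficulty: M] -/
@[route_item "route-AtomisticToContinuum-BenjaminiSchrammPeriodicSupport", crux]
def ChargedPeriodicIsOptimal : Prop :=
  ∀ Q : Literature.MathematicalPhysics.StatisticalMechanics.PeriodicConfiguration 3, (∃ x : (N : ℕ) → (Fin N → EuclideanSpace ℝ (Fin 3)), (∀ N, Literature.MathematicalPhysics.StatisticalMechanics.IsGroundState Literature.MathematicalPhysics.StatisticalMechanics.lennardJones (x N)) ∧ ∀ R ε : ℝ, 0 < R → 0 < ε → ∃ ρ : ℝ, 0 < ρ ∧ ∃ᶠ N : ℕ in Filter.atTop, ρ * (N : ℝ) ≤ (Nat.card {i : Fin N // ∃ A : EuclideanSpace ℝ (Fin 3) →ₗᵢ[ℝ] EuclideanSpace ℝ (Fin 3), ∃ q ∈ Q.points, (∀ s ∈ Q.points, dist s q ≤ R → ∃ j : Fin N, dist (x N j) (x N i + A (s - q)) ≤ ε) ∧ (∀ j : Fin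 N, dist (x N j) (x N i) ≤ R → ∃ s ∈ Q.points, dist (x N j) (x N i + A (s - q)) ≤ ε)} : ℝ)) → IsLeast (Set.range fun Q' : Literature.MathematicalPhysics.StatisticalMechanics.PeriodicConfiguration 3 => Q'.energyPerParticle Literature.MathematicalPhysics.StatisticalMechanics.lennardJones) (Q.energyPerParticle Literature.MathematicalPhysics.StatisticalMechanics.lennardJones)

/-- `ChargedPeriodicIsOptimal` holds: proved by `Summit.AtomisticToContinuum.Crystallization.Theorems.chargedPeriodicIsOptimal_proof`. -/
theorem ChargedPeriodicIsOptimal_holds : ChargedPeriodicIsOptimal := _root_.Summit.AtomisticToContinuum.Crystallization.Theorems.chargedPeriodicIsOptimal_proof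

/-- item stmt-AtomisticToContinuum-2916 · support · rank 9 · closed · proved by Summit.AtomisticToContinuum.Crystallization.Theorems.chargedPatternCrystallizes_proof (prover) · by planner
sources: BlancLewin2015, stmt-AtomisticToContinuum-2916
[support] (soft) GroundStatesChargePeriodic → LennardJonesMinimalDistance → IsCrystallizing
lennardJones 3: choose scales (k, 1/k), indices N_k ↑ with a good particle i_k, isometries A_k → A
along a subsequence (compactness of O(3)), τ_k := −x_(i_k) + alignment; the two-way matching with
minimal distance is eventually exact near every compact set, so
PeriodicConfiguration.tendsto_sum_of_eventually_near' (in tree) gives local convergence to the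
periodic configuration A(Q − q) (isometryImage/translate in CrystallizationSymmetries), multiplicity
1. [difficulty: M] -/
@[route_item "route-AtomisticToContinuum-BenjaminiSchrammPeriodicSupport", crux]
def ChargedPatternCrystallizes : Prop :=
  GroundStatesChargePeriodic → Literature.MathematicalPhysics.StatisticalMechanics.LennardJonesMinimalDistance → Literature.MathematicalPhysics.StatisticalMechanics.IsCrystallizing Literature.MathematicalPhysics.StatisticalMechanics.lennardJones 3

/-- `ChargedPatternCrystallizes` holds: proved by `Summit.AtomisticToContinuum.Crystallization.Theorems.chargedPatternCrystallizes_proof`. -/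
theorem ChargedPatternCrystallizes_holds : ChargedPatternCrystallizes := _root_.Summit.AtomisticToContinuum.Crystallization.Theorems.chargedPatternCrystallizes_proof

/-- item stmt-AtomisticToContinuum-9230 · support · rank 9 · closed · proved by Summit.AtomisticToContinuum.Crystallization.Theorems.benjaminiSchrammLimit_proof_periodicSupport @ 44e2423ddfbc (prover) · by planner
sources: AldousLyons2007, AldousSteele2004, LastPenrose2017, HevelingLast2005, BlancLewin2015, stmt-AtomisticToContinuum-9230
[support] CONSTRUCTION (card U3; existence kept separate from the interface): for every sequence of
LJ ground states x^N there are a subsequence φ, a hard core δ > 0 and a probability law P on rooted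
δ-separated configurations which is point-stationary, has E_P[h] = lim_j E(φ j)/φ j (stated as
Tendsto), and is a LOCAL LIMIT in the density-transfer (portmanteau) form the assembly uses: for
every set T of configurations, every R, ε > 0 and every ρ < P(T), for all large j at least ρ·φ(j)
particles i of x^(φ j) have their recentred configuration (R, ε)-matched (both ways, inside the ball
of radius R) to some ν ∈ T. Proof: P_N := (1/N) Σ_i δ_(count|(x^N − x_i)); mass transport is an
exact finite identity; E_(P_N)[h] = E(N)/N; compactness of rooted (1/3)-separated configurations in
the local topology (LennardJonesMinimalDistance_holds); h is a uniform limit of bounded local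
continuous functionals (tail ≤ C R^-3); unimodularity passes to the limit; transfer by Skorokhod /
portmanteau with open fattenings. [difficulty: XL] -/
@[route_item "route-AtomisticToContinuum-BenjaminiSchrammPeriodicSupport"]
def BenjaminiSchrammLimit : Prop :=
  ∀ x : (N : ℕ) → (Fin N → EuclideanSpace ℝ (Fin 3)), (∀ N, Literature.MathematicalPhysics.StatisticalMechanics.IsGroundState Literature.MathematicalPhysics.StatisticalMechanics.lennardJones (x N)) → ∃ φ : ℕ → ℕ, StrictMono φ ∧ ∃ δ : ℝ, 0 < δ ∧ ∃ P : MeasureTheory.Measure (MeasureTheory.Measure (EuclideanSpace ℝ (Fin 3))), MeasureTheory.IsProbabilityMeasure P ∧ (∀ᵐ μ ∂P, (∃ S : Set (EuclideanSpace ℝ (Fin 3)), (0 : EuclideanSpace ℝ (Fin 3)) ∈ S ∧ (∀ x ∈ S, ∀ y ∈ S, x ≠ y → δ ≤ dist x y) ∧ μ = (MeasureTheory.Measure.count : MeasureTheory.Measure (EuclideanSpace ℝ (Fin 3))).restrict S)) ∧ (∀ g : MeasureTheory.Measure (EuclideanSpace ℝ (Fin 3)) → EuclideanSpace ℝ (Fin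 3) → ENNReal, Measurable (Function.uncurry g) → ∫⁻ μ, ∫⁻ y, g μ y ∂μ ∂P = ∫⁻ μ, ∫⁻ y, g (MeasureTheory.Measure.map (fun z => z - y) μ) (-y) ∂μ ∂P) ∧ Filter.Tendsto (fun j : ℕ => Literature.MathematicalPhysics.StatisticalMechanics.groundStateEnergy Literature.MathematicalPhysics.StatisticalMechanics.lennardJones 3 (φ j) / (φ j : ℝ)) Filter.atTop (nhds (∫ μ, (∫ y, Literature.MathematicalPhysics.StatisticalMechanics.lennardJones ‖y‖ ∂μ) / 2 ∂P)) ∧ ∀ T : Set (MeasureTheory.Measure (EuclideanSpace ℝ (Fin 3))), ∀ R ε : ℝ, 0 < ε → ∀ ρ : ℝ, ρ < (P T).toReal → ∀ᶠ j : ℕ in Filter.atTop, ρ * (φ j : ℝ) ≤ (Nat.card {i : Fin (φ j) // ∃ ν ∈ T, ((∀ p : EuclideanSpace ℝ (Fin 3), ν {p} ≠ 0 → ‖p‖ ≤ R → ∃ q ∈ (Set.range (fun k : Fin (φ j) => x (φ j) k - x (φ j) i)), dist q p ≤ ε) ∧ (∀ q ∈ (Set.range (fun k : Fin (φ j) =>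 x (φ j) k - x (φ j) i)), ‖q‖ ≤ R → ∃ p : EuclideanSpace ℝ (Fin 3), ν {p} ≠ 0 ∧ dist q p ≤ ε))} : ℝ)

-- `BenjaminiSchrammLimit` holds: proved by `Summit.AtomisticToContinuum.Crystallization.Theorems.benjaminiSchrammLimit_proof_periodicSupport` @ 44e2423ddfbc (its module imports this route file, so no `_holds` link can be stated here).

/-- item stmt-AtomisticToContinuum-12749 · assembly · rank 1 · open · by planner
sources: BlancLewin2015, AldousLyons2007
[assembly] GroundStatesChargePeriodic → CrysEnergyLimit → ChargedPeriodicIsOptimal →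
ChargedPatternCrystallizes → Crystallization (the sub-problem decl `_root_.Crystallization`);
provable now by the `closes` script (`assembly_holds` in the Sketch). -/
@[route_item "route-AtomisticToContinuum-BenjaminiSchrammPeriodicSupport"]
def Assembly : Prop :=
  GroundStatesChargePeriodic → CrysEnergyLimit → ChargedPeriodicIsOptimal → ChargedPatternCrystallizes → _root_.Crystallization

/-! D-0027 §2.1 — DECIDING THEOREM (planner-authored via `route open/edit --closes-file`; by planner-plancard-AtomisticToContinuum-Crystal-e7276692-g2-0 2026-08-15T18:56:19Z):
its hypotheses are this route's items and its conclusion the sub-problem Statement (glue_lint), and it elaborates with this file. -/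

@[closes "route-AtomisticToContinuum-BenjaminiSchrammPeriodicSupport"] theorem closes : GroundStatesChargePeriodic → CrysEnergyLimit → ChargedPeriodicIsOptimal →
    ChargedPatternCrystallizes → _root_.Crystallization := by
  intro hGCP hLim hOpt hCryst
  show Literature.MathematicalPhysics.StatisticalMechanics.HasPeriodicGroundStateEnergy
      Literature.MathematicalPhysics.StatisticalMechanics.lennardJones 3 ∧
    Literature.MathematicalPhysics.StatisticalMechanics.IsCrystallizing
      Literature.MathematicalPhysics.StatisticalMechanics.lennardJones 3
  refine ⟨?_, hCryst hGCP
    Literature.MathematicalPhysics.StatisticalMechanics.LennardJonesMinimalDistance_holds⟩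
  -- conjunct (i): a ground-state sequence exists (proved fact); the hinge charges ONE periodic `Q`;
  -- surgery-attainment makes `e(Q)` the least periodic energy; `⨅ = e(Q)` turns the energy limit
  -- into convergence to `e(Q)`.
  choose x hx using
    (show ∀ N : ℕ, ∃ y : Fin N → EuclideanSpace ℝ (Fin 3),
        Literature.MathematicalPhysics.StatisticalMechanics.IsGroundState
          Literature.MathematicalPhysics.StatisticalMechanics.lennardJones y from
      Literature.MathematicalPhysics.StatisticalMechanics.LennardJonesGroundStatesExist_holds)
  obtain ⟨Q, hQ⟩ := hGCP x hx
  have hleast := hOpt Q ⟨x, hx, hQ⟩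
  refine ⟨Q, hleast, ?_⟩
  have h1 : (⨅ Q' : Literature.MathematicalPhysics.StatisticalMechanics.PeriodicConfiguration 3,
      Q'.energyPerParticle Literature.MathematicalPhysics.StatisticalMechanics.lennardJones) =
      Q.energyPerParticle Literature.MathematicalPhysics.StatisticalMechanics.lennardJones :=
    hleast.csInf_eq
  rw [← h1]
  exact hLim

end Summit.AtomisticToContinuum.Crystallization.Theses.BenjaminiSchrammPeriodicSupport
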